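import Mathlib
import Summits.Langlands.Langlands.Theorems.PicardMuOrdinaryResidualAutomorphyOddCoeff
import Literature.NumberTheory.GaloisRepresentations.TateProjectiveLifting
import Literature.NumberTheory.Automorphic.SerreConjectureProofs
import Literature.NumberTheory.Automorphic.BaseChangeCyclicCuspidal
import Literature.NumberTheory.Automorphic.GelbartJacquetSymmSquare
import Literature.NumberTheory.Automorphic.TunnellOctahedralGlobalProofs
import Literature.NumberTheory.Automorphic.AlgebraicityTwist
import Literature.NumberTheory.Automorphic.CuspidalRepDataOfL2Satake
import Literature.NumberTheory.Automorphic.Sweep1SymmetricPowerGelbartHolds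
import Literature.NumberTheory.Automorphic.AutomorphicTwistWeightOne
import Literature.NumberTheory.Automorphic.LanglandsTunnellLSeriesProofs
import Literature.NumberTheory.Automorphic.GLnAdelicStructureProofs
import Literature.NumberTheory.GaloisRepresentations.SerreWeightLowerBoundProofs
import Literature.NumberTheory.GaloisRepresentations.CubicResidueSymbol
import HarnessLib

/-!
# Assembly helpers for `ResidualAutomorphyOdd` (helper for item stmt-Langlands-13759, route PicardMuOrdinary)

Transfer of polynomial identities to a quotient of `ℤ̄`, the embedding `toZbar` of the coefficient
integers of a newform, `K = ℚ(ω)` (`Kω`, degree `2`), cofinite bookkeeping over places, the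
coefficients of the Hecke polynomial, Frobenius traces/determinants of `ρ̄_g` (`frob_trace_det`), the
non-dihedral clause transported to `ρ̄_g` (`nonDihedral`) and a maximal ideal of `ℤ̄` above the kernel
of the reduction map of the coefficient integers (`exists_maximal_over_ker`).
-/

set_option linter.dupNamespace false -- project-wide option (lakefile weak.linter.dupNamespace); `Summit.Langlands.Langlands` is the mandated namespace

noncomputable section

open scoped NumberField Classical Polynomial MatrixGroups
open Filter IsDedekindDomain Polynomial
open Literature.NumberTheory.Automorphic Literature.NumberTheory.GaloisRepresentations
open Literature.NumberTheory.EllipticCurves.ModularForms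

namespace Summit.Langlands.Langlands.Theorems.ResidualAutomorphyOdd

/-! ### Assembly -/

section Transfer

/-- Transfer of a polynomial identity from the residue field `k` of `ι` to the quotient `M ⧸ 𝔐`,
when `𝔐` pulls back to `ker ι`. -/
theorem map_map_mk_eq_of_map_eq {O L M : Type*} [CommRing O] [Field L] [CommRing M]
    (ι : O →+* L) (j : O →+* M) (𝔐 : Ideal M) (h𝔐 : 𝔐.comap j = RingHom.ker ι)
    {Q : O[X]} {T : ℤ[X]} (h : Q.map ι = T.map (Int.castRingHom L)) :
    (Q.map j).map (Ideal.Quotient.mk 𝔐) = T.map (Int.castRingHom (M ⧸ 𝔐)) := by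
  set φ₁ : O ⧸ RingHom.ker ι →+* L := RingHom.kerLift ι with hφ₁def
  have hφ₁ : Function.Injective φ₁ := RingHom.kerLift_injective ι
  have hle : ∀ x ∈ RingHom.ker ι, ((Ideal.Quotient.mk 𝔐).comp j) x = 0 := by
    intro x hx
    rw [← h𝔐, Ideal.mem_comap] at hx
    simpa [Ideal.Quotient.eq_zero_iff_mem] using hx
  set φ₂ : O ⧸ RingHom.ker ι →+* M ⧸ 𝔐 := Ideal.Quotient.lift (RingHom.ker ι) ((Ideal.Quotient.mk 𝔐).comp j) hle
    with hφ₂def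
  have e1 : φ₁.comp (Ideal.Quotient.mk (RingHom.ker ι)) = ι :=
    RingHom.ext fun x => RingHom.kerLift_mk ι x
  have e2 : φ₂.comp (Ideal.Quotient.mk (RingHom.ker ι)) = (Ideal.Quotient.mk 𝔐).comp j :=
    RingHom.ext fun x => rfl
  have h1 : (Q.map (Ideal.Quotient.mk (RingHom.ker ι))).map φ₁ =
      (T.map (Int.castRingHom (O ⧸ RingHom.ker ι))).map φ₁ := by
    rw [Polynomial.map_map, Polynomial.map_map, e1, h, RingHom.ext_int (φ₁.comp _) (Int.castRingHom L)]
  have h2 : Q.map (Ideal.Quotient.mk (RingHom.ker ι)) = T.map (Int.castRingHom (O ⧸ RingHom.ker ι)) :=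
    Polynomial.map_injective φ₁ hφ₁ h1
  have h3 := congrArg (Polynomial.map φ₂) h2
  rw [Polynomial.map_map, Polynomial.map_map, e2, ← Polynomial.map_map,
    RingHom.ext_int (φ₂.comp _) (Int.castRingHom (M ⧸ 𝔐))] at h3
  exact h3

end Transfer

section Embedding

variable {N : ℕ} [NeZero N] {k : ℤ}

/-- The ring `ℤ̄ ⊆ ℂ` of algebraic integers. -/
abbrev Zbar : Type := ↥(integralClosure ℤ ℂ)

/-- The inclusion `𝓞_g ↪ ℤ̄` of the coefficient integers of a cusp form into the algebraic integers
of `ℂ`. -/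
def toZbar (g : CuspForm (CongruenceSubgroup.Gamma1 N) k) : coeffCharIntegers g →+* Zbar :=
  (((IsScalarTower.toAlgHom ℤ (coeffCharField g) ℂ).comp (coeffCharIntegers g).val).codRestrict
      (integralClosure ℤ ℂ) (fun x => by
        change IsIntegral ℤ (algebraMap (coeffCharField g) ℂ (x : coeffCharField g))
        exact x.2.algebraMap)).toRingHom

/-- Unfolding `toZbar` in `ℂ`. -/
@[simp] theorem toZbar_apply_coe (g : CuspForm (CongruenceSubgroup.Gamma1 N) k) (x : coeffCharIntegers g) :
    ((toZbar g x : Zbar) : ℂ) = ((x : coeffCharField g) : ℂ) := rfl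

/-- `toZbar` is injective. -/
theorem toZbar_injective (g : CuspForm (CongruenceSubgroup.Gamma1 N) k) :
    Function.Injective (toZbar g) := by
  intro x y h
  have h' : ((toZbar g x : Zbar) : ℂ) = ((toZbar g y : Zbar) : ℂ) := by rw [h]
  rw [toZbar_apply_coe, toZbar_apply_coe] at h'
  exact Subtype.ext (Subtype.ext h')

end Embedding

/-- Abbreviation for `K = ℚ(ω)`. -/
abbrev Kω : Type := CyclotomicField 3 ℚ

/-- `[ℚ(ω) : ℚ] = 2`. -/
theorem finrank_Kω : Module.finrank ℚ Kω = 2 := by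
  haveI : IsCyclotomicExtension {3} ℚ Kω := CyclotomicField.isCyclotomicExtension 3 ℚ
  rw [IsCyclotomicExtension.finrank Kω (Polynomial.cyclotomic.irreducible_rat (by norm_num : 0 < 3))]
  decide

/-- Finitely many places of `K` lie over a finite set of places of `ℚ`. -/
theorem finite_setOf_under_mem {B : Set (HeightOneSpectrum (𝓞 ℚ))} (hB : B.Finite) :
    {𝔭 : HeightOneSpectrum (𝓞 Kω) | ∃ v ∈ B, 𝔭.asIdeal.under (𝓞 ℚ) = v.asIdeal}.Finite := by
  have : {𝔭 : HeightOneSpectrum (𝓞 Kω) | ∃ v ∈ B, 𝔭.asIdeal.under (𝓞 ℚ) = v.asIdeal} =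
      ⋃ v ∈ B, {𝔭 : HeightOneSpectrum (𝓞 Kω) | 𝔭.asIdeal.under (𝓞 ℚ) = v.asIdeal} := by
    ext 𝔭; simp
  rw [this]
  refine hB.biUnion fun v _ => ?_
  have hfin : (v.asIdeal.primesOver (𝓞 Kω)).Finite := IsDedekindDomain.primesOver_finite v.asIdeal (𝓞 Kω)
  refine (hfin.preimage (f := fun 𝔭 : HeightOneSpectrum (𝓞 Kω) => 𝔭.asIdeal) ?_).subset ?_
  · exact fun x _ y _ hxy => HeightOneSpectrum.ext hxy
  · intro 𝔭 h𝔭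
    exact ⟨𝔭.isPrime, ⟨h𝔭.symm⟩⟩

section MatrixCharpoly

/-- The trace of a `2 × 2` matrix from its characteristic polynomial. -/
theorem trace_eq_neg_coeff_of_charpoly_eq {L : Type*} [Field L] {M : Matrix (Fin 2) (Fin 2) L}
    {P : L[X]} (h : M.charpoly = P) : M.trace = -P.coeff 1 := by
  rw [← h, Matrix.charpoly_fin_two]
  simp

/-- The determinant of a `2 × 2` matrix from its characteristic polynomial. -/
theorem det_eq_coeff_of_charpoly_eq {L : Type*} [Field L] {M : Matrix (Fin 2) (Fin 2) L}
    {P : L[X]} (h : M.charpoly = P) : M.det = P.coeff 0 := by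
  rw [← h, Matrix.charpoly_fin_two]
  simp

variable {N : ℕ} [NeZero N] {k : ℤ}

/-- The linear coefficient of the Hecke polynomial is `-a_q`. -/
theorem coeff_one_heckePolynomial (g : CuspForm (CongruenceSubgroup.Gamma1 N) k) (q : ℕ) :
    ((Literature.NumberTheory.EllipticCurves.ModularForms.heckePolynomial g q).coeff 1 : ℂ) =
      -(UpperHalfPlane.qExpansion 1 ⇑g).coeff q := by
  simp [Literature.NumberTheory.EllipticCurves.ModularForms.heckePolynomial, coeff_C]

/-- The constant coefficient of the Hecke polynomial is `ε(q) q^{k-1}`. -/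
theorem coeff_zero_heckePolynomial (g : CuspForm (CongruenceSubgroup.Gamma1 N) k) (q : ℕ) :
    ((Literature.NumberTheory.EllipticCurves.ModularForms.heckePolynomial g q).coeff 0 : ℂ) =
      (nebentypus g (q : ZMod N) : ℂ) * (q : ℂ) ^ (k - 1) := by
  simp [Literature.NumberTheory.EllipticCurves.ModularForms.heckePolynomial, coeff_C]

/-- The values of a Dirichlet character at units are roots of unity of order dividing
`#(ℤ/N)ˣ`. -/
theorem nebentypus_pow_card_units (g : CuspForm (CongruenceSubgroup.Gamma1 N) k) {q : ℕ}
    (hq : q.Coprime N) :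
    (nebentypus g (q : ZMod N)) ^ Fintype.card (ZMod N)ˣ = 1 := by
  set u : (ZMod N)ˣ := ZMod.unitOfCoprime q hq with hu
  have hq' : (q : ZMod N) = (u : ZMod N) := by simp [hu]
  rw [hq', ← map_pow, ← Units.val_pow_eq_pow_val, pow_card_eq_one, Units.val_one, map_one]

end MatrixCharpoly

section Core

variable {N : ℕ} [NeZero N] {w : ℕ}

/-- Frobenius traces and determinants of `σ = ρ̄_g` in terms of the Hecke data of `g`. -/
theorem frob_trace_det {σ : FramedGaloisRep ℚ K3 2} {g : CuspForm (CongruenceSubgroup.Gamma1 N) (w : ℤ)}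
    {ιg : coeffCharIntegers g →+* K3} {T : Set ℕ} (hρ : IsGaloisRepOfNewform1Int g ιg T σ)
    (v : HeightOneSpectrum (𝓞 ℚ))
    (hv : ((Rat.HeightOneSpectrum.primesEquiv v : Nat.Primes) : ℕ) ∉ T)
    {𝔓 : Ideal (absIntegers (𝓞 ℚ) ℚ)} (h𝔓 : 𝔓 ∈ v.primesAbove) {Φ : Field.absoluteGaloisGroup ℚ}
    (hΦ : IsArithFrobAt (𝓞 ℚ) Φ 𝔓) :
    ∃ (a b : coeffCharIntegers g),
      Matrix.trace ((σ Φ : GL (Fin 2) K3) : Matrix (Fin 2) (Fin 2) K3) = ιg a ∧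
      Matrix.det ((σ Φ : GL (Fin 2) K3) : Matrix (Fin 2) (Fin 2) K3) = ιg b ∧
      ((a : coeffCharField g) : ℂ) =
        (UpperHalfPlane.qExpansion 1 ⇑g).coeff ((Rat.HeightOneSpectrum.primesEquiv v : Nat.Primes) : ℕ) ∧
      ((b : coeffCharField g) : ℂ) =
        (nebentypus g (((Rat.HeightOneSpectrum.primesEquiv v : Nat.Primes) : ℕ) : ZMod N) : ℂ) *
          (((Rat.HeightOneSpectrum.primesEquiv v : Nat.Primes) : ℕ) : ℂ) ^ ((w : ℤ) - 1) := by
  obtain ⟨-, Pg, hPg, hchar⟩ := hρ v hv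
  have hc : FramedRep.charpoly σ Φ = Pg.map ιg := hchar 𝔓 h𝔓 Φ hΦ
  set p : ℕ := ((Rat.HeightOneSpectrum.primesEquiv v : Nat.Primes) : ℕ) with hp
  have h1 : algebraMap (coeffCharIntegers g) (coeffCharField g) (Pg.coeff 1) =
      (Literature.NumberTheory.EllipticCurves.ModularForms.heckePolynomial g p).coeff 1 := by
    rw [← Polynomial.coeff_map, hPg]
  have h0 : algebraMap (coeffCharIntegers g) (coeffCharField g) (Pg.coeff 0) =
      (Literature.NumberTheory.EllipticCurves.ModularForms.heckePolynomial g p).coeff 0 := by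
    rw [← Polynomial.coeff_map, hPg]
  refine ⟨-Pg.coeff 1, Pg.coeff 0, ?_, ?_, ?_, ?_⟩
  · rw [trace_eq_neg_coeff_of_charpoly_eq hc, Polynomial.coeff_map, map_neg]
  · rw [det_eq_coeff_of_charpoly_eq hc, Polynomial.coeff_map]
  · have h1' := congrArg (fun x : coeffCharField g => (x : ℂ)) h1
    rw [coeff_one_heckePolynomial] at h1'
    have : (((-Pg.coeff 1 : coeffCharIntegers g) : coeffCharField g) : ℂ) =
        -((algebraMap (coeffCharIntegers g) (coeffCharField g) (Pg.coeff 1) : coeffCharField g) : ℂ) := rfl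
    rw [this, h1', neg_neg]
  · have h0' := congrArg (fun x : coeffCharField g => (x : ℂ)) h0
    rw [coeff_zero_heckePolynomial] at h0'
    exact h0'

/-- Injectivity of `𝓞_g → K_g`. -/
theorem algebraMap_coeffCharIntegers_injective (g : CuspForm (CongruenceSubgroup.Gamma1 N) (w : ℤ)) :
    Function.Injective (algebraMap (coeffCharIntegers g) (coeffCharField g)) :=
  Subtype.val_injective

/-- Non-dihedrality of `g` from the Galois side. -/
theorem nonDihedral {σ : FramedGaloisRep ℚ K3 2} {g : CuspForm (CongruenceSubgroup.Gamma1 N) (w : ℤ)}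
    {ιg : coeffCharIntegers g →+* K3} (hρ : IsGaloisRepOfNewform1Int g ιg {q : ℕ | q ∣ N * 3} σ)
    (hND : ∀ (K' : Type) [Field K'] [NumberField K'] [Algebra ℚ K'], Module.finrank ℚ K' = 2 →
        {v : HeightOneSpectrum (𝓞 ℚ) | quadraticSign K' v = -1 ∧ σ.IsUnramifiedAt v ∧
          ∃ 𝔓 ∈ v.primesAbove, ∃ Φ : Field.absoluteGaloisGroup ℚ,
            IsArithFrobAt (𝓞 ℚ) Φ 𝔓 ∧ Matrix.trace ((σ Φ : GL (Fin 2) K3) : Matrix (Fin 2) (Fin 2) K3) ≠ 0}.Infinite) :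
    ∀ (K' : Type) [Field K'] [NumberField K'] [Algebra ℚ K'], Module.finrank ℚ K' = 2 →
      {v : HeightOneSpectrum (𝓞 ℚ) | quadraticSign K' v = -1 ∧
        (UpperHalfPlane.qExpansion 1 ⇑g).coeff (Rat.HeightOneSpectrum.primesEquiv v) ≠ 0}.Infinite := by
  intro K' _ _ _ hK'
  have hfin : {v : HeightOneSpectrum (𝓞 ℚ) |
      ((Rat.HeightOneSpectrum.primesEquiv v : Nat.Primes) : ℕ) ∣ N * 3}.Finite := by
    have hT : {q : ℕ | q ∣ N * 3}.Finite :=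
      (Nat.divisors (N * 3)).finite_toSet.subset fun q hq =>
        Nat.mem_divisors.2 ⟨hq, mul_ne_zero (NeZero.ne N) (by norm_num)⟩
    have hset : {v : HeightOneSpectrum (𝓞 ℚ) |
        ((Rat.HeightOneSpectrum.primesEquiv v : Nat.Primes) : ℕ) ∣ N * 3} =
        (fun v : HeightOneSpectrum (𝓞 ℚ) => ((Rat.HeightOneSpectrum.primesEquiv v : Nat.Primes) : ℕ)) ⁻¹'
          {q : ℕ | q ∣ N * 3} := rfl
    rw [hset]
    exact hT.preimage fun x _ y _ hxy =>
      (Rat.HeightOneSpectrum.primesEquiv (R := 𝓞 ℚ)).injective (Subtype.ext hxy)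
  refine ((hND K' hK').sdiff hfin).mono ?_
  rintro v ⟨⟨hqs, -, 𝔓, h𝔓, Φ, hΦ, htr⟩, hv⟩
  refine ⟨hqs, fun h0 => htr ?_⟩
  obtain ⟨a, b, hta, -, ha, -⟩ := frob_trace_det hρ v hv h𝔓 hΦ
  rw [hta]
  have : a = 0 := by
    apply algebraMap_coeffCharIntegers_injective g
    apply Subtype.ext
    change ((a : coeffCharField g) : ℂ) = (((0 : coeffCharIntegers g) : coeffCharField g) : ℂ)
    rw [ha, h0]
    simp
  rw [this, map_zero]

/-- A maximal ideal `𝔐` of `ℤ̄ ⊆ ℂ` above the kernel of `ιg : 𝓞_g → 𝔽̄₃`. -/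
theorem exists_maximal_over_ker (g : CuspForm (CongruenceSubgroup.Gamma1 N) (w : ℤ))
    (ιg : coeffCharIntegers g →+* K3) :
    ∃ 𝔐 : Ideal Zbar, 𝔐.IsMaximal ∧ 𝔐.comap (toZbar g) = RingHom.ker ιg ∧ (3 : Zbar) ∈ 𝔐 := by
  set 𝔪 : Ideal (coeffCharIntegers g) := RingHom.ker ιg with h𝔪def
  have h3𝔪 : (3 : coeffCharIntegers g) ∈ 𝔪 := by
    rw [h𝔪def, RingHom.mem_ker, map_ofNat, three_eq_zero_K3]
  haveI : Algebra.IsIntegral ℤ (coeffCharIntegers g) :=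
    inferInstanceAs (Algebra.IsIntegral ℤ (integralClosure ℤ (coeffCharField g)))
  haveI h𝔪max : 𝔪.IsMaximal := by
    haveI hprime : 𝔪.IsPrime := RingHom.ker_isPrime ιg
    refine Ideal.isMaximal_of_isIntegral_of_isMaximal_comap (R := ℤ) 𝔪 ?_
    have hmax3 : (Ideal.span {(3 : ℤ)}).IsMaximal :=
      PrincipalIdealRing.isMaximal_of_irreducible Int.prime_three.irreducible
    have hp3 : 𝔪.comap (algebraMap ℤ (coeffCharIntegers g)) = Ideal.span {(3 : ℤ)} := by
      have h3 : Ideal.span {(3 : ℤ)} ≤ 𝔪.comap (algebraMap ℤ (coeffCharIntegers g)) := by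
        rw [Ideal.span_singleton_le_iff_mem, Ideal.mem_comap, map_ofNat]
        exact h3𝔪
      exact (hmax3.eq_of_le (Ideal.IsPrime.ne_top inferInstance) h3).symm
    rw [hp3]
    exact hmax3
  letI : Algebra (coeffCharIntegers g) Zbar := (toZbar g).toAlgebra
  haveI : Algebra.IsIntegral (coeffCharIntegers g) Zbar :=
    ⟨fun x => (Algebra.IsIntegral.isIntegral (R := ℤ) x).tower_top⟩
  obtain ⟨𝔐, h𝔐max, h𝔐comap⟩ := Ideal.exists_ideal_over_maximal_of_isIntegral (S := Zbar) 𝔪 (by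
    have : RingHom.ker (algebraMap (coeffCharIntegers g) Zbar) = ⊥ :=
      (RingHom.injective_iff_ker_eq_bot _).1 (toZbar_injective g)
    rw [this]; exact bot_le)
  refine ⟨𝔐, h𝔐max, h𝔐comap, ?_⟩
  have : (algebraMap (coeffCharIntegers g) Zbar) 3 ∈ 𝔐 := by
    rw [← Ideal.mem_comap, h𝔐comap]; exact h3𝔪
  rwa [map_ofNat] at this

/-! ### Residue-field bookkeeping at good primes of `ℚ(ω)` -/

omit [NeZero N] in
/-- `3 ∤ 𝔭` for the good primes. -/
theorem three_not_mem {𝔭 : HeightOneSpectrum (𝓞 Kω)} {v : HeightOneSpectrum (𝓞 ℚ)}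
    (hunder : 𝔭.asIdeal.under (𝓞 ℚ) = v.asIdeal)
    (hpN : ¬ ((Rat.HeightOneSpectrum.primesEquiv v : Nat.Primes) : ℕ) ∣ N * 3) :
    (3 : 𝓞 Kω) ∉ 𝔭.asIdeal := by
  intro h3
  set p : ℕ := ((Rat.HeightOneSpectrum.primesEquiv v : Nat.Primes) : ℕ) with hpdef
  have hp : p.Prime := (Rat.HeightOneSpectrum.primesEquiv v).2
  have h3v : (3 : 𝓞 ℚ) ∈ v.asIdeal := by
    rw [← hunder, Ideal.under_def, Ideal.mem_comap, map_ofNat]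
    exact h3
  have hpv : (p : 𝓞 ℚ) ∈ v.asIdeal := by
    have h := Ideal.absNorm_mem v.asIdeal
    have hres : Ideal.absNorm v.asIdeal = p := by
      rw [← HeightOneSpectrum.residueCard, residueCard_eq_primesEquiv]
    rwa [hres] at h
  by_cases hp3 : p = 3
  · exact hpN ⟨N, by rw [hp3]; ring⟩
  · have hcop : Nat.Coprime p 3 := (Nat.coprime_primes hp Nat.prime_three).2 hp3
    obtain ⟨u, t, hut⟩ := (Nat.isCoprime_iff_coprime.2 hcop)
    have h1 : (1 : 𝓞 ℚ) ∈ v.asIdeal := by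
      have : (u : 𝓞 ℚ) * (p : 𝓞 ℚ) + (t : 𝓞 ℚ) * 3 = 1 := by exact_mod_cast hut
      rw [← this]
      exact v.asIdeal.add_mem (v.asIdeal.mul_mem_left _ hpv) (v.asIdeal.mul_mem_left _ h3v)
    exact v.isPrime.ne_top ((Ideal.eq_top_iff_one _).2 h1)

/-- Residue-degree bookkeeping at a good prime `𝔭 ∤ 3` of `K = ℚ(ω)` over `p`. -/
theorem residue_data {𝔭 : HeightOneSpectrum (𝓞 Kω)} {v : HeightOneSpectrum (𝓞 ℚ)}
    (hunder : 𝔭.asIdeal.under (𝓞 ℚ) = v.asIdeal) (h3 : (3 : 𝓞 Kω) ∉ 𝔭.asIdeal) :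
    1 ≤ 𝔭.asIdeal.inertiaDeg (𝓞 ℚ) ∧ 𝔭.asIdeal.inertiaDeg (𝓞 ℚ) ≤ 2 ∧
      𝔭.residueCard = ((Rat.HeightOneSpectrum.primesEquiv v : Nat.Primes) : ℕ) ^ 𝔭.asIdeal.inertiaDeg (𝓞 ℚ) ∧
      ((((Rat.HeightOneSpectrum.primesEquiv v : Nat.Primes) : ℕ) : K3)) ^ 𝔭.asIdeal.inertiaDeg (𝓞 ℚ) = 1 := by
  haveI : 𝔭.asIdeal.LiesOver v.asIdeal := ⟨hunder.symm⟩
  have he1 : 1 ≤ 𝔭.asIdeal.inertiaDeg (𝓞 ℚ) := Ideal.inertiaDeg_pos 𝔭.asIdeal (𝓞 ℚ)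
  have he2 : 𝔭.asIdeal.inertiaDeg (𝓞 ℚ) ≤ 2 := by
    haveI : NoZeroSMulDivisors (𝓞 ℚ) (𝓞 Kω) := ⟨fun {c x} h => by
      rw [Algebra.smul_def, mul_eq_zero] at h
      exact h.imp_left fun hc =>
        (NumberField.RingOfIntegers.algebraMap.injective ℚ Kω) (by rw [hc, map_zero])⟩
    have h := Ideal.inertiaDeg_le_finrank (𝓞 Kω) ℚ Kω (p := v.asIdeal) 𝔭.asIdeal v.ne_bot
    rw [Ideal.inertiaDeg'_eq_inertiaDeg, finrank_Kω] at h
    exact h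
  have hN : 𝔭.residueCard = ((Rat.HeightOneSpectrum.primesEquiv v : Nat.Primes) : ℕ) ^ 𝔭.asIdeal.inertiaDeg (𝓞 ℚ) := by
    rw [← residueCard_eq_primesEquiv, HeightOneSpectrum.residueCard, HeightOneSpectrum.residueCard,
      Ideal.absNorm_pow_inertiaDeg]
  refine ⟨he1, he2, hN, ?_⟩
  obtain ⟨ζ, hζ⟩ := exists_isPrimitiveRoot_three_cyclotomicField
  have h3dvd := three_dvd_residueCard_sub_one hζ h3
  obtain ⟨c, hc⟩ := h3dvd
  have h1 : 1 ≤ 𝔭.residueCard := (HeightOneSpectrum.one_lt_residueCard 𝔭).le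
  have hres : 𝔭.residueCard = 3 * c + 1 := by omega
  have : ((𝔭.residueCard : ℕ) : K3) = 1 := by
    rw [hres]; push_cast; rw [three_eq_zero_K3]; ring
  rw [← Nat.cast_pow, ← hN, this]

/-- `N𝔭 = p^f` for a prime `𝔭` of `K` over `p`. -/
theorem residueCard_eq_pow {𝔭 : HeightOneSpectrum (𝓞 Kω)} {v : HeightOneSpectrum (𝓞 ℚ)}
    (hunder : 𝔭.asIdeal.under (𝓞 ℚ) = v.asIdeal) :
    𝔭.residueCard = ((Rat.HeightOneSpectrum.primesEquiv v : Nat.Primes) : ℕ) ^ 𝔭.asIdeal.inertiaDeg (𝓞 ℚ) := by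
  haveI : 𝔭.asIdeal.LiesOver v.asIdeal := ⟨hunder.symm⟩
  rw [← residueCard_eq_primesEquiv, HeightOneSpectrum.residueCard, HeightOneSpectrum.residueCard,
    Ideal.absNorm_pow_inertiaDeg]

/-- Normal form of a twice-rescaled adjoint Satake parameter. -/
theorem adjoint_triple_map_map (r c d : ℂ) :
    ((({r, r⁻¹, 1} : Multiset ℂ).map fun z => c * z).map fun z => d * z) =
      {d * c * r, d * c * r⁻¹, d * c} := by
  simp only [Multiset.insert_eq_cons, Multiset.map_cons, Multiset.map_singleton, mul_one]
  congr 1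
  · ring
  · congr 1
    ring

end Core

end Summit.Langlands.Langlands.Theorems.ResidualAutomorphyOdd
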